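import Summits.CriticalPhenomena.CardyFormulaZ2.Theses.CardyPickBootstrap
import Literature.Probability.RandomPlanarGeometry.CardyFunctionIncBeta

/-!
# Strategist sketch — crux `EBUniqueness` (stmt-CriticalPhenomena-8391), route CardyPickBootstrap

Unit `cstrat-stmt-CriticalPhenomena-8391-r1` (crux-strategist, RESTATED re-audit flavour).

Contents
* §0  vocabulary (`kappa0`, `SolvesEB`, `Admissible`) — abbreviations only; every ROUTE-LEVEL
      signature below (§2) is literal and self-contained so it can be pasted into `ledger route edit`.
* §1  the decomposition attempts D1–D3 of `EBUniqueness` AS TYPED (∀ κ > 0), each with its assembly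
      actually proved — they exhibit the seam; each contains the piece that inherits the numerical
      refutation of the item (see STRATEGY-CENSUS.md), so none is filed.
* §2  RESTATE KIT for the tenure planner / human (route KILL CRITERIA pivot): the restated crux
      `EBUniquenessK0` (κ := √3/(2π)), the κ-pinning crux `KappaPinning`, the BC2-redirect
      decomposition `KernelRigidityK0 ∧ CardySolvesEB → EBUniquenessK0` with a NON-trivial
      assembly (normalisation argument), and the re-certified deciding theorem `closes_restated`.
-/

namespace Summit.CriticalPhenomena.CardyFormulaZ2.Cruxes.EBUniqueness.Strategist

open scoped Topology
open Filter Set MeasureTheory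
open Summit.CriticalPhenomena.CardyFormulaZ2.Theses.CardyPickBootstrap
open Literature.Probability.RandomPlanarGeometry (cardyFunction)

/-! ## §0 Vocabulary -/

/-- Cardy's bootstrap constant `κ₀ = √3/(2π)` (= sin(π/3)/π: the indicial root α = 1/3). -/
noncomputable def kappa0 : ℝ := Real.sqrt 3 / (2 * Real.pi)

/-- `p` solves the excursion bootstrap at coupling `κ` on (0,1) (literal shape of the hypothesis of
`EBUniqueness`). -/
def SolvesEB (p : ℝ → ℝ) (κ : ℝ) : Prop :=
  ∀ s ∈ Set.Ioo (0:ℝ) 1, HasDerivAt p (κ * ∫ x in (0:ℝ)..1,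
    p x * (((1 - s * (1 - x)) ^ 2)⁻¹ + ((x + s * (1 - x)) ^ 2)⁻¹)) s

/-- The a-priori shape of a sublimit (`APrioriShape`'s conclusion). -/
def Admissible (p : ℝ → ℝ) : Prop :=
  (∀ s ∈ Set.Ioo (0:ℝ) 1, p s ∈ Set.Icc (0:ℝ) 1) ∧ MonotoneOn p (Set.Ioo (0:ℝ) 1) ∧
    Tendsto p (𝓝[>] 0) (𝓝 0) ∧ Tendsto p (𝓝[<] 1) (𝓝 1)

/-- `EBUniqueness` unfolded into the vocabulary (definitional). -/
theorem ebUniqueness_iff :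
    EBUniqueness ↔ ∀ (p : ℝ → ℝ) (κ : ℝ), 0 < κ → Admissible p → SolvesEB p κ →
      ∀ s ∈ Set.Ioo (0:ℝ) 1, p s = cardyFunction s := by
  constructor
  · intro h p κ hκ hA hS
    exact h p κ hκ hA.1 hA.2.1 hA.2.2.1 hA.2.2.2 hS
  · intro h p κ hκ hI hM h0 h1 hS
    exact h p κ hκ ⟨hI, hM, h0, h1⟩ hS

/-! ## §1 Decomposition attempts of `EBUniqueness` as typed (∀ κ > 0)

Each assembly is proved; each is a modus-ponens chain (trivial seam, BC2(b)), and in each the piece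
quantifying over ALL κ is the statement refuted numerically on the item (the admissible family
`p_κ`, κ ∈ (0,1/π], corner exponent arcsin(πκ)/π): `KappaForcing`, `CornerExponentThird`. -/

/-- D1, piece 1 (∀κ — inherits the refutation: p_{1/4} is admissible, solves EB at κ = 1/4 ≠ κ₀). -/
def KappaForcing : Prop :=
  ∀ (p : ℝ → ℝ) (κ : ℝ), 0 < κ → Admissible p → SolvesEB p κ → κ = kappa0

/-- D1, piece 2 = the surviving form of the crux (κ fixed at κ₀); numerically supported (σ₂ ≈ 1). -/
def EBRigidityK0 : Prop :=
  ∀ (p : ℝ → ℝ), Admissible p → SolvesEB p kappa0 → ∀ s ∈ Set.Ioo (0:ℝ) 1, p s = cardyFunction s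

/-- D1 assembly — a 3-line seam (`obtain rfl; exact`): violates BC2(b), and piece 1 is refuted. -/
theorem ebUniqueness_of_D1 (h₁ : KappaForcing) (h₂ : EBRigidityK0) : EBUniqueness := by
  rw [ebUniqueness_iff]
  intro p κ hκ hA hS
  obtain rfl : κ = kappa0 := h₁ p κ hκ hA hS
  exact h₂ p hA hS

/-- D2, piece 1 (∀κ — inherits the refutation: p_κ ~ s^{arcsin(πκ)/π}, exponent 1/3 only at κ₀). -/
def CornerExponentThird : Prop :=
  ∀ (p : ℝ → ℝ) (κ : ℝ), 0 < κ → Admissible p → SolvesEB p κ →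
    ∃ c : ℝ, 0 < c ∧ Tendsto (fun s => p s / s ^ (1 / 3 : ℝ)) (𝓝[>] 0) (𝓝 c)

/-- D2, piece 2 (true in substance: the indicial equation sin(πα) = πκ at α = 1/3 gives κ = κ₀). -/
def ExponentPinsKappa : Prop :=
  ∀ (p : ℝ → ℝ) (κ : ℝ), 0 < κ → Admissible p → SolvesEB p κ →
    (∃ c : ℝ, 0 < c ∧ Tendsto (fun s => p s / s ^ (1 / 3 : ℝ)) (𝓝[>] 0) (𝓝 c)) → κ = kappa0

/-- D2 assembly — again a modus-ponens chain; piece 1 is refuted. -/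
theorem ebUniqueness_of_D2 (h₁ : CornerExponentThird) (h₂ : ExponentPinsKappa) (h₃ : EBRigidityK0) :
    EBUniqueness := by
  rw [ebUniqueness_iff]
  intro p κ hκ hA hS
  obtain rfl : κ = kappa0 := h₂ p κ hκ hA hS (h₁ p κ hκ hA hS)
  exact h₃ p hA hS

/-- D3, piece 1 (linear rigidity at EVERY coupling: the bounded solutions vanishing at 0⁺ form a space
of dimension ≤ 1) — numerically supported for κ ≤ 1/π (σ₂ = O(1)); this is the honest analytic core. -/
def KernelRigidity (κ : ℝ) : Prop :=
  ∀ (p q : ℝ → ℝ), (∃ M : ℝ, ∀ s ∈ Set.Ioo (0:ℝ) 1, |p s| ≤ M) →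
    (∃ M : ℝ, ∀ s ∈ Set.Ioo (0:ℝ) 1, |q s| ≤ M) →
    Tendsto p (𝓝[>] 0) (𝓝 0) → Tendsto q (𝓝[>] 0) (𝓝 0) → SolvesEB p κ → SolvesEB q κ →
    ∃ a b : ℝ, (a ≠ 0 ∨ b ≠ 0) ∧ ∀ s ∈ Set.Ioo (0:ℝ) 1, a * p s = b * q s

/-- D3, piece 2 (∀κ: NO admissible solution off κ₀) — this IS `KappaForcing`; refuted numerically.
D3 = `KernelRigidity kappa0 ∧ KappaForcing ∧ CardySolvesEB → EBUniqueness`: its assembly is the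
non-trivial normalisation argument of §2, but the ∀κ piece is again the refuted one. -/
def NoSolutionOffK0 : Prop := KappaForcing

/-! ## §2 RESTATE KIT (route KILL CRITERIA: "restate EBUniqueness with the minimal extra input") -/

/-- PROPOSED RESTATED CRUX (1:1 for `EBUniqueness`, κ := √3/(2π)); literal, self-contained. -/
def EBUniquenessK0 : Prop :=
  ∀ (p : ℝ → ℝ), (∀ s ∈ Set.Ioo (0:ℝ) 1, p s ∈ Set.Icc (0:ℝ) 1) → MonotoneOn p (Set.Ioo (0:ℝ) 1) → Filter.Tendsto p (nhdsWithin 0 (Set.Ioi 0)) (nhds 0) → Filter.Tendsto p (nhdsWithin 1 (Set.Iio 1)) (nhds 1) → (∀ s ∈ Set.Ioo (0:ℝ) 1, HasDerivAt p (Real.sqrt 3 / (2 * Real.pi) * ∫ x in (0:ℝ)..1, p x * (((1 - s * (1 - x)) ^ 2)⁻¹ + ((x + s * (1 - x)) ^ 2)⁻¹)) s) → ∀ s ∈ Set.Ioo (0:ℝ) 1, p s = Literature.Probability.RandomPlanarGeometry.cardyFunction s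

/-- PROPOSED NEW CRUX pinning the launch constant of ℤ² sublimits (a consequence of `CardyFormulaZ2`,
used toward it: if an η-sublimit of a sliding family solves the bootstrap with SOME κ > 0 then
κ = √3/(2π) — the ℤ² value of the boundary exponent, sin(πα) = πκ, α = 1/3); literal. -/
def KappaPinning : Prop :=
  ∀ (Q : ℝ → Literature.Probability.RandomPlanarGeometry.ConformalRectangle), ((∀ η ∈ Set.Ioo (0:ℝ) 1, ∀ η' ∈ Set.Ioo (0:ℝ) 1, (Q η).toJordanDomain = (Q η').toJordanDomain ∧ (Q η).mark 0 = (Q η').mark 0 ∧ (Q η).mark 1 = (Q η').mark 1 ∧ (Q η).mark 2 = (Q η').mark 2) ∧ (∀ η ∈ Set.Ioo (0:ℝ) 1, ∀ (φ : Literature.Probability.RandomPlanarGeometry.ConformalEquiv UpperHalfPlane.upperHalfPlaneSet (Q η).carrier) (x : Fin 4 → ℝ), (Q η).IsUniformizing φ x → Literature.Probability.RandomPlanarGeometry.crossRatio x = η)) → ∀ (δs : ℕ → ℝ), (∀ k : ℕ, 0 < δs k) → Filter.Tendsto δs Filter.atTop (nhds 0) → ∀ (p : ℝ → ℝ), (∀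 η ∈ Set.Ioo (0:ℝ) 1, Filter.Tendsto (fun k : ℕ => Literature.Probability.Percolation.bondDomainCrossingProb (Q η) (δs k)) Filter.atTop (nhds (p η))) → ∀ (κ : ℝ), 0 < κ → (∀ s ∈ Set.Ioo (0:ℝ) 1, HasDerivAt p (κ * ∫ x in (0:ℝ)..1, p x * (((1 - s * (1 - x)) ^ 2)⁻¹ + ((x + s * (1 - x)) ^ 2)⁻¹)) s) → κ = Real.sqrt 3 / (2 * Real.pi)

/-- BC2-REDIRECT PIECE for the restated crux: linear rigidity of the bootstrap at κ₀ — any two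
bounded solutions on (0,1) vanishing at 0⁺ are linearly dependent (dim ker ≤ 1; no positivity,
no monotonicity, no normalisation, no Cardy function); literal, self-contained. -/
def KernelRigidityK0 : Prop :=
  ∀ (p q : ℝ → ℝ), (∃ M : ℝ, ∀ s ∈ Set.Ioo (0:ℝ) 1, |p s| ≤ M) → (∃ M : ℝ, ∀ s ∈ Set.Ioo (0:ℝ) 1, |q s| ≤ M) → Filter.Tendsto p (nhdsWithin 0 (Set.Ioi 0)) (nhds 0) → Filter.Tendsto q (nhdsWithin 0 (Set.Ioi 0)) (nhds 0) → (∀ s ∈ Set.Ioo (0:ℝ) 1, HasDerivAt p (Real.sqrt 3 / (2 * Real.pi) * ∫ x in (0:ℝ)..1, p x * (((1 - s * (1 - x)) ^ 2)⁻¹ + ((x + s * (1 - x)) ^ 2)⁻¹)) s) → (∀ s ∈ Set.Ioo (0:ℝ) 1, HasDerivAt q (Real.sqrt 3 / (2 * Real.pi) * ∫ x in (0:ℝ)..1, q x * (((1 - s * (1 - x)) ^ 2)⁻¹ + ((x + s * (1 - x)) ^ 2)⁻¹)) s) → ∃ a b : ℝ, (a ≠ 0 ∨ b ≠ 0) ∧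 ∀ s ∈ Set.Ioo (0:ℝ) 1, a * p s = b * q s

theorem kernelRigidityK0_iff : KernelRigidityK0 ↔ KernelRigidity kappa0 := Iff.rfl

theorem ebUniquenessK0_iff :
    EBUniquenessK0 ↔ ∀ (p : ℝ → ℝ), Admissible p → SolvesEB p kappa0 →
      ∀ s ∈ Set.Ioo (0:ℝ) 1, p s = cardyFunction s := by
  constructor
  · intro h p hA hS
    exact h p hA.1 hA.2.1 hA.2.2.1 hA.2.2.2 hS
  · intro h p hI hM h0 h1 hS
    exact h p ⟨hI, hM, h0, h1⟩ hS

/-- `F → 0` at `0⁺` (from continuity on [0,1] and F(0) = 0). -/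
theorem tendsto_cardyFunction_zero : Tendsto cardyFunction (𝓝[>] (0:ℝ)) (𝓝 0) := by
  have hc : ContinuousWithinAt cardyFunction (Set.Icc (0:ℝ) 1) 0 :=
    Literature.Probability.RandomPlanarGeometry.continuousOn_cardyFunction_holds 0 ⟨le_rfl, zero_le_one⟩
  have h : Tendsto cardyFunction (𝓝[Set.Icc (0:ℝ) 1] 0) (𝓝 (cardyFunction 0)) := hc.tendsto
  rw [Literature.Probability.RandomPlanarGeometry.cardyFunction_zero] at h
  have hle : 𝓝[>] (0:ℝ) ≤ 𝓝[Set.Icc (0:ℝ) 1] 0 := by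
    rw [← nhdsWithin_Ioo_eq_nhdsGT (zero_lt_one' ℝ)]
    exact nhdsWithin_mono _ Set.Ioo_subset_Icc_self
  exact h.mono_left hle

/-- `F → 1` at `1⁻` (from continuity on [0,1] and F(1) = 1). -/
theorem tendsto_cardyFunction_one : Tendsto cardyFunction (𝓝[<] (1:ℝ)) (𝓝 1) := by
  have hc : ContinuousWithinAt cardyFunction (Set.Icc (0:ℝ) 1) 1 :=
    Literature.Probability.RandomPlanarGeometry.continuousOn_cardyFunction_holds 1 ⟨zero_le_one, le_rfl⟩
  have h : Tendsto cardyFunction (𝓝[Set.Icc (0:ℝ) 1] 1) (𝓝 (cardyFunction 1)) := hc.tendsto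
  have h1 : cardyFunction 1 = 1 := Literature.Probability.RandomPlanarGeometry.cardyFunction_one_holds
  rw [h1] at h
  have hle : 𝓝[<] (1:ℝ) ≤ 𝓝[Set.Icc (0:ℝ) 1] 1 := by
    rw [← nhdsWithin_Ioo_eq_nhdsLT (zero_lt_one' ℝ)]
    exact nhdsWithin_mono _ Set.Ioo_subset_Icc_self
  exact h.mono_left hle

/-- `F(1/2) > 0`. -/
theorem cardyFunction_half_pos : 0 < cardyFunction (1 / 2) := by
  have h := Literature.Probability.RandomPlanarGeometry.strictMonoOn_cardyFunction_holds
    ⟨le_rfl, zero_le_one⟩ ⟨by norm_num, by norm_num⟩ (by norm_num : (0:ℝ) < 1 / 2)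
  rwa [Literature.Probability.RandomPlanarGeometry.cardyFunction_zero] at h

/-- **BC2-redirect assembly for the restated crux** (non-trivial seam: instantiate the rigidity with
q := F, rule out the degenerate dependence by F(1/2) > 0, identify the constant by the two limits
at 1⁻ and uniqueness of limits along the non-trivial filter 𝓝[<] 1). -/
theorem ebUniquenessK0_of_kernelRigidity (hKR : KernelRigidityK0) (hF : CardySolvesEB) :
    EBUniquenessK0 := by
  intro p hIcc hmono h0 h1 hD s hs
  -- boundedness of p and F on (0,1)
  have hpB : ∃ M : ℝ, ∀ x ∈ Set.Ioo (0:ℝ) 1, |p x| ≤ M :=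
    ⟨1, fun x hx => abs_le.mpr ⟨by linarith [(hIcc x hx).1], (hIcc x hx).2⟩⟩
  have hFB : ∃ M : ℝ, ∀ x ∈ Set.Ioo (0:ℝ) 1, |cardyFunction x| ≤ M := by
    refine ⟨1, fun x hx => ?_⟩
    have hx' := Literature.Probability.RandomPlanarGeometry.cardyFunction_mem_Icc_holds
      (Set.Ioo_subset_Icc_self hx)
    exact abs_le.mpr ⟨by linarith [hx'.1], hx'.2⟩
  -- linear dependence of p and F
  obtain ⟨a, b, hab, hlin⟩ :=
    hKR p cardyFunction hpB hFB h0 tendsto_cardyFunction_zero hD hF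
  -- the coefficient of p cannot vanish
  have ha : a ≠ 0 := by
    intro ha0
    have hb : b ≠ 0 := by
      rcases hab with h | h
      · exact absurd ha0 h
      · exact h
    have hhalf := hlin (1 / 2) ⟨by norm_num, by norm_num⟩
    rw [ha0, zero_mul] at hhalf
    exact (mul_ne_zero hb cardyFunction_half_pos.ne') hhalf.symm
  -- hence p = c • F on (0,1) with c = b / a
  have hpc : ∀ x ∈ Set.Ioo (0:ℝ) 1, p x = b / a * cardyFunction x := by
    intro x hx
    have hx' := hlin x hx
    field_simp
    linarith [hx']
  -- identify c from the limits at 1⁻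
  have hev : ∀ᶠ x in 𝓝[<] (1:ℝ), x ∈ Set.Ioo (0:ℝ) 1 := by
    rw [← nhdsWithin_Ioo_eq_nhdsLT (zero_lt_one' ℝ)]
    exact self_mem_nhdsWithin
  have hlimc : Tendsto p (𝓝[<] (1:ℝ)) (𝓝 (b / a * 1)) := by
    have h' : Tendsto (fun x => b / a * cardyFunction x) (𝓝[<] (1:ℝ)) (𝓝 (b / a * 1)) :=
      tendsto_cardyFunction_one.const_mul (b / a)
    refine h'.congr' ?_
    filter_upwards [hev] with x hx
    exact (hpc x hx).symm
  have hc1 : b / a = 1 := by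
    have hu := tendsto_nhds_unique hlimc h1
    simpa using hu
  rw [hpc s hs, hc1, one_mul]

/-- **Re-certified deciding theorem for the restated route** (same nine items with `EBUniqueness`
replaced by `EBUniquenessK0` + `KappaPinning`): the proof is the route's `closes` verbatim up to the
last three steps. -/
theorem closes_restated (hPick : PickLimit) (hLaunch : LaunchLaw) (hMoeb : MoebiusCovariance)
    (hEB0 : EBUniquenessK0) (hPin : KappaPinning) (hShape : APrioriShape) (hL2B : LaunchToBootstrap)
    (hHelly : HellySelection) (hSub : SubsequencePrinciple) (hFam : FamiliesExist) :
    _root_.CardyFormulaZ2 := by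
  intro R φ x hφx
  obtain ⟨QA, QB, QC, hSA, hSB, hSC, hCompB, hCompC, η₀, hη₀, hcar, harc0, harc2, hmod⟩ := hFam R
  have hP : Literature.Probability.Percolation.bondDomainCrossingProb R =
      Literature.Probability.Percolation.bondDomainCrossingProb (QA η₀) := by
    funext δ
    unfold Literature.Probability.Percolation.bondDomainCrossingProb
    rw [hcar, harc0, harc2]
  rw [hmod φ x hφx, hP]
  refine hSub QA hSA ?_ η₀ hη₀
  intro δs hpos hδ
  obtain ⟨σ₁, hσ₁, pA, hA⟩ := hHelly QA hSA δs hpos hδ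
  have hpos₁ : ∀ k : ℕ, 0 < (fun k => δs (σ₁ k)) k := fun k => hpos _
  have hδ₁ : Tendsto (fun k => δs (σ₁ k)) atTop (𝓝 0) := hδ.comp hσ₁.tendsto_atTop
  obtain ⟨σ₂, hσ₂, pB, hB⟩ := hHelly QB hSB (fun k => δs (σ₁ k)) hpos₁ hδ₁
  have hpos₂ : ∀ k : ℕ, 0 < (fun k => δs (σ₁ (σ₂ k))) k := fun k => hpos _
  have hδ₂ : Tendsto (fun k => δs (σ₁ (σ₂ k))) atTop (𝓝 0) := hδ₁.comp hσ₂.tendsto_atTop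
  obtain ⟨σ₃, hσ₃, pC, hC⟩ := hHelly QC hSC (fun k => δs (σ₁ (σ₂ k))) hpos₂ hδ₂
  have hσ : StrictMono (fun k => σ₁ (σ₂ (σ₃ k))) := hσ₁.comp (hσ₂.comp hσ₃)
  have hposσ : ∀ k : ℕ, 0 < (fun k => δs (σ₁ (σ₂ (σ₃ k)))) k := fun k => hpos _
  have hδσ : Tendsto (fun k => δs (σ₁ (σ₂ (σ₃ k)))) atTop (𝓝 0) := hδ₂.comp hσ₃.tendsto_atTop
  have hA' : ∀ η ∈ Set.Ioo (0:ℝ) 1, Tendsto (fun k : ℕ =>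
      Literature.Probability.Percolation.bondDomainCrossingProb (QA η)
        ((fun k => δs (σ₁ (σ₂ (σ₃ k)))) k)) atTop (𝓝 (pA η)) :=
    fun η hη => (hA η hη).comp ((hσ₂.comp hσ₃).tendsto_atTop)
  have hB' : ∀ η ∈ Set.Ioo (0:ℝ) 1, Tendsto (fun k : ℕ =>
      Literature.Probability.Percolation.bondDomainCrossingProb (QB η)
        ((fun k => δs (σ₁ (σ₂ (σ₃ k)))) k)) atTop (𝓝 (pB η)) :=
    fun η hη => (hB η hη).comp hσ₃.tendsto_atTop
  have hC' : ∀ η ∈ Set.Ioo (0:ℝ) 1, Tendsto (fun k : ℕ =>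
      Literature.Probability.Percolation.bondDomainCrossingProb (QC η)
        ((fun k => δs (σ₁ (σ₂ (σ₃ k)))) k)) atTop (𝓝 (pC η)) := hC
  obtain ⟨β, μ, hβ, hμ0, hint, hder⟩ := hPick QA hSA _ hposσ hδσ pA hA'
  have hCompB' : ∀ η ∈ Set.Ioo (0:ℝ) 1, ∀ η' ∈ Set.Ioo (0:ℝ) 1,
      (QB η).carrier = (QA η').carrier ∧
        ((QB η).arc 0 = (QA η').arc 1 ∨ (QB η).arc 0 = (QA η').arc 0) ∧
          (QB η).arc 1 = (QA η').arc 2 ∪ (QA η').arc 3 :=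
    fun η hη η' hη' => ⟨(hCompB η hη η' hη').1, Or.inl (hCompB η hη η' hη').2.1,
      (hCompB η hη η' hη').2.2⟩
  have hCompC' : ∀ η ∈ Set.Ioo (0:ℝ) 1, ∀ η' ∈ Set.Ioo (0:ℝ) 1,
      (QC η).carrier = (QA η').carrier ∧
        ((QC η).arc 0 = (QA η').arc 1 ∨ (QC η).arc 0 = (QA η').arc 0) ∧
          (QC η).arc 1 = (QA η').arc 2 ∪ (QA η').arc 3 :=
    fun η hη η' hη' => ⟨(hCompC η hη η' hη').1, Or.inr (hCompC η hη η' hη').2.1,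
      (hCompC η hη η' hη').2.2⟩
  have hBA : ∀ η ∈ Set.Ioo (0:ℝ) 1, pB η = pA η :=
    hMoeb QA QB hSA hSB hCompB' _ hposσ hδσ pA pB hA' hB'
  have hCA : ∀ η ∈ Set.Ioo (0:ℝ) 1, pC η = pA η :=
    hMoeb QA QC hSA hSC hCompC' _ hposσ hδσ pA pC hA' hC'
  obtain ⟨κ, hκ, hβ0, hμeq⟩ :=
    hLaunch QA QB QC hSA hSB hSC hCompB hCompC _ hposσ hδσ pA pB pC hA' hB' hC' β μ
      ⟨hβ, hμ0, hint, hder⟩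
  obtain ⟨hIcc, hmono, hlim0, hlim1⟩ := hShape QA hSA _ hposσ hδσ pA hA'
  have hμA : μ = MeasureTheory.volume.withDensity (fun t : ℝ => ENNReal.ofReal (κ *
      ((Set.Ioi (1:ℝ)).indicator (fun u : ℝ => pA ((u - 1) / u)) t +
        (Set.Iio (0:ℝ)).indicator (fun u : ℝ => pA (u / (u - 1))) t))) := by
    rw [hμeq]
    congr 1
    funext t
    have e1 : (Set.Ioi (1:ℝ)).indicator (fun u : ℝ => pB ((u - 1) / u)) t =
        (Set.Ioi (1:ℝ)).indicator (fun u : ℝ => pA ((u - 1) / u)) t := by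
      by_cases ht : t ∈ Set.Ioi (1:ℝ)
      · rw [Set.indicator_of_mem ht, Set.indicator_of_mem ht]
        have ht1 : (1:ℝ) < t := ht
        apply hBA
        refine ⟨div_pos (by linarith) (by linarith), ?_⟩
        rw [div_lt_one (by linarith)]
        linarith
      · simp only [Set.indicator, if_neg ht]
    have e2 : (Set.Iio (0:ℝ)).indicator (fun u : ℝ => pC (u / (u - 1))) t =
        (Set.Iio (0:ℝ)).indicator (fun u : ℝ => pA (u / (u - 1))) t := by
      by_cases ht : t ∈ Set.Iio (0:ℝ)
      · rw [Set.indicator_of_mem ht, Set.indicator_of_mem ht]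
        have ht0 : t < 0 := ht
        apply hCA
        refine ⟨div_pos_of_neg_of_neg ht0 (by linarith), ?_⟩
        rw [div_lt_one_of_neg (by linarith)]
        linarith
      · simp only [Set.indicator, if_neg ht]
    rw [e1, e2]
  have hderiv : ∀ s ∈ Set.Ioo (0:ℝ) 1, HasDerivAt pA (κ * ∫ x in (0:ℝ)..1, pA x *
      (((1 - s * (1 - x)) ^ 2)⁻¹ + ((x + s * (1 - x)) ^ 2)⁻¹)) s := by
    intro s hs
    have h := hder s hs
    rw [hβ0, hμA, hL2B pA κ s hκ hs hIcc hmono, zero_add] at h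
    exact h
  -- NEW: pin κ = κ₀ from the lattice side, then apply the restated rigidity
  have hκ0 : κ = Real.sqrt 3 / (2 * Real.pi) := hPin QA hSA _ hposσ hδσ pA hA' κ hκ hderiv
  rw [hκ0] at hderiv
  have hpF : ∀ s ∈ Set.Ioo (0:ℝ) 1,
      pA s = Literature.Probability.RandomPlanarGeometry.cardyFunction s :=
    hEB0 pA hIcc hmono hlim0 hlim1 hderiv
  exact ⟨fun k => σ₁ (σ₂ (σ₃ k)), hσ, pA, hA', hpF⟩


/-! ### §2b Variant B of the pinning input (more informative): the boundary EXPONENT 1/3 of sublimits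
(continuum form of the half-plane one-arm exponent, cf. item stmt-CriticalPhenomena-5662) as the
percolation crux, and the indicial identity `sin(πα) = πκ` at α = 1/3 as a pure-analysis support. -/

/-- PROPOSED CRUX (variant B): every sliding-family sublimit has boundary exponent exactly 1/3 at η → 0⁺
(consequence of CardyFormulaZ2: F(s)/s^{1/3} → cardyConst). -/
def SublimitExponentThird : Prop :=
  ∀ (Q : ℝ → Literature.Probability.RandomPlanarGeometry.ConformalRectangle), ((∀ η ∈ Set.Ioo (0:ℝ) 1, ∀ η' ∈ Set.Ioo (0:ℝ) 1, (Q η).toJordanDomain = (Q η').toJordanDomain ∧ (Q η).mark 0 = (Q η').mark 0 ∧ (Q η).mark 1 = (Q η').mark 1 ∧ (Q η).mark 2 = (Q η').mark 2) ∧ (∀ η ∈ Set.Ioo (0:ℝ) 1, ∀ (φ : Literature.Probability.RandomPlanarGeometry.ConformalEquiv UpperHalfPlane.upperHalfPlaneSet (Q η).carrier) (x : Fin 4 → ℝ), (Q η).IsUniformizing φ x → Literature.Probability.RandomPlanarGeometry.crossRatio x = η)) → ∀ (δs : ℕ → ℝ), (∀ k : ℕ, 0 < δs k) → Filter.Tendsto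 δs Filter.atTop (nhds 0) → ∀ (p : ℝ → ℝ), (∀ η ∈ Set.Ioo (0:ℝ) 1, Filter.Tendsto (fun k : ℕ => Literature.Probability.Percolation.bondDomainCrossingProb (Q η) (δs k)) Filter.atTop (nhds (p η))) → ∃ c : ℝ, 0 < c ∧ Filter.Tendsto (fun s : ℝ => p s / s ^ (1 / 3 : ℝ)) (nhdsWithin 0 (Set.Ioi 0)) (nhds c)

/-- PROPOSED SUPPORT (variant B, pure analysis, M): exponent 1/3 pins the coupling — Abelian asymptotics
of `A p` at the corner (`∫₀^∞ u^{1/3}(1+u)⁻² du = (π/3)/sin(π/3)`) and integration of `p′`. -/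
def ExponentThirdPinsKappa : Prop :=
  ∀ (p : ℝ → ℝ) (κ : ℝ), 0 < κ → (∀ s ∈ Set.Ioo (0:ℝ) 1, p s ∈ Set.Icc (0:ℝ) 1) → MonotoneOn p (Set.Ioo (0:ℝ) 1) → (∃ c : ℝ, 0 < c ∧ Filter.Tendsto (fun s : ℝ => p s / s ^ (1 / 3 : ℝ)) (nhdsWithin 0 (Set.Ioi 0)) (nhds c)) → (∀ s ∈ Set.Ioo (0:ℝ) 1, HasDerivAt p (κ * ∫ x in (0:ℝ)..1, p x * (((1 - s * (1 - x)) ^ 2)⁻¹ + ((x + s * (1 - x)) ^ 2)⁻¹)) s) → κ = Real.sqrt 3 / (2 * Real.pi)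

/-- Deciding theorem, variant B (EBUniquenessK0 + SublimitExponentThird + ExponentThirdPinsKappa). -/
theorem closes_restatedB (hPick : PickLimit) (hLaunch : LaunchLaw) (hMoeb : MoebiusCovariance)
    (hEB0 : EBUniquenessK0) (hExp : SublimitExponentThird) (hPinB : ExponentThirdPinsKappa)
    (hShape : APrioriShape) (hL2B : LaunchToBootstrap)
    (hHelly : HellySelection) (hSub : SubsequencePrinciple) (hFam : FamiliesExist) :
    _root_.CardyFormulaZ2 := by
  -- KappaPinning follows from the two variant-B items and APrioriShape; then reuse `closes_restated`.
  refine closes_restated hPick hLaunch hMoeb hEB0 ?_ hShape hL2B hHelly hSub hFam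
  intro Q hQ δs hpos hδ p hp κ hκ hD
  obtain ⟨hIcc, hmono, -, -⟩ := hShape Q hQ δs hpos hδ p hp
  exact hPinB p κ hκ hIcc hmono (hExp Q hQ δs hpos hδ p hp) hD

/-- Sanity: the ORIGINAL crux implies the restated one (κ₀ > 0), so the restate is a weakening. -/
theorem ebUniquenessK0_of_ebUniqueness (h : EBUniqueness) : EBUniquenessK0 := by
  intro p hI hM h0 h1 hD
  exact h p _ (by positivity) hI hM h0 h1 hD

/-- Sanity: `KappaPinning` is what the original crux would give on sublimits for free
(EBUniqueness ⇒ p = F, and then κ is forced since F solves EB at κ₀ and at κ) — recorded informally;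
the restated route needs it as a separate lattice-side input. -/
example : True := trivial

end Summit.CriticalPhenomena.CardyFormulaZ2.Cruxes.EBUniqueness.Strategist
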